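import Mathlib
import Literature.Geometry.Lorentzian.ReggeWheelerTortoise
import Literature.Geometry.Lorentzian.ReggeWheelerChannels

/-!
# Sketch — crux-ideate, crux `stmt-FinalStateConjecture-14075`
(`PhotonSphereChannels.ChannelsResolveTameDevelopmentsR`, K2R = `K1R → Φ`), round 1, ideator 1.

First lemmas of the two idea cards filed by this seat (statements only; they must elaborate):

* `SilentModesAreStatic` — card `kerr-isolation-dichotomy`: the linear, exact-Schwarzschild
  shadow of the ISOLATION step, and the first typed place where the route's channel inequality
  (in its per-mode form `FixedModeChannels`, K1R ⇒ FixedModeChannels) does work inside `Φ`: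
  per-mode two-ended channels for all apertures `ρ ≥ ρ₀` + two-sided silence at every base time
  + bounded energy ⇒ the Regge–Wheeler mode is static.
* `HullDichotomy` — card `kerr-isolation-dichotomy`: the pure point-set topology of the
  dichotomy (ω-limit sets of flows on compact Hausdorff spaces are connected): provable now.
* `TwoSidedTrappingTime` — card `trapped-set-observability-analyticity`: the linear,
  exact-Schwarzschild shadow of two-sided sub-exponential observability of the photon sphere:
  a finite-energy Regge–Wheeler mode keeping a fraction `1 − δ` of its energy inside a FIXED
  tortoise ball about the photon sphere at BOTH times `−T` and `+T` has
  `T ≤ C(M, ρ)(1 + log(ℓ+1))` — the Ehrenfest time of the unstable photon orbit, i.e. the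
  logarithm that sizes the log-ball of K1R.
-/

noncomputable section

open scoped BigOperators Topology ENNReal
open Filter Set Function MeasureTheory

namespace Summit.FinalStateConjecture.FinalStateConjecture.Cruxes.ChannelsResolveTameDevelopmentsR

open Literature.Geometry.Lorentzian Literature.Geometry.Lorentzian.ReggeWheeler

/-- **Silent modes are static** (card `kerr-isolation-dichotomy`, first lemma). For the
Regge–Wheeler mode `(s, ℓ)` on Schwarzschild of mass `M` in the tortoise line (`IsTortoiseRadius`):
if the two-ended exterior channel inequality holds about the photon-sphere centre `xc` with one
constant `c > 0` for every aperture `ρ ≥ ρ₀` (the conclusion shape of the route's support item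
`FixedModeChannels`, hence of K1R), then every global `C²` solution `ψ` with energy bounded for all
times whose channel energies through all four ends vanish AT EVERY BASE TIME `t₀` (two-sided
silence: nothing reaches `𝓘^±`, nothing crosses `𝓗^±`) is static.  Paper proof: silence ⇒ zero
kernel deficit at every base time ⇒ (finite-energy kernel is finite-dimensional per mode, hence
closed) `ψ` is a `t`-polynomial on every exterior cone ⇒ one `t`-polynomial on
`{|x − xc| > ρ₀} × ℝ` ⇒ constant in `t` there by boundedness ⇒ static inside the ball by sideways
(x-directed) domain of dependence for the 1+1 equation with `t`-independent potential applied to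
`ψ(t + h, ·) − ψ(t, ·)`. -/
def SilentModesAreStatic : Prop :=
  ∀ (M : ℝ), 0 < M → ∀ (r : ℝ → ℝ) (xc : ℝ), IsTortoiseRadius M r xc →
  ∀ (s ℓ : ℕ), s ≤ 2 → s ≤ ℓ → ∀ (ρ₀ c : ℝ), 0 < c →
  (∀ ρ : ℝ, ρ₀ ≤ ρ → ChannelInequality (linePotential M s ℓ r) xc ρ c) →
  ∀ ψ : ℝ → ℝ → ℝ, IsRWSolution M s ℓ r ψ →
  (∃ E : ℝ≥0∞, E ≠ ⊤ ∧ ∀ t : ℝ, totalEnergy (linePotential M s ℓ r) ψ t ≤ E) →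
  (∀ (t₀ ρ : ℝ), ρ₀ ≤ ρ →
      channelEnergy (linePotential M s ℓ r) xc ρ (fun t x ↦ ψ (t₀ + t) x) atTop = 0 ∧
      channelEnergy (linePotential M s ℓ r) xc ρ (fun t x ↦ ψ (t₀ + t) x) atBot = 0) →
  ∀ t x : ℝ, ψ t x = ψ 0 x

/-- **Hull dichotomy** (card `kerr-isolation-dichotomy`, the point-set core; provable now).
For a continuous flow on a compact Hausdorff space, the ω-limit set of a point is connected; hence
if it lies in a closed set `S` (the silent hull elements) inside which `K` (the Kerr stratum) is
closed and relatively open (ISOLATION), then the ω-limit set lies in `K` or misses `K`. -/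
def HullDichotomy : Prop :=
  ∀ (H : Type) [TopologicalSpace H] [CompactSpace H] [T2Space H] (ϕ : Flow ℝ H)
    (S K : Set H) (x : H),
    IsClosed S → IsClosed K → K ⊆ S → (∃ U : Set H, IsOpen U ∧ U ∩ S = K) →
    omegaLimit atTop (fun t y ↦ ϕ t y) {x} ⊆ S →
    omegaLimit atTop (fun t y ↦ ϕ t y) {x} ⊆ K ∨
      Disjoint (omegaLimit atTop (fun t y ↦ ϕ t y) {x}) K

/-- **Two-sided trapping time at the photon sphere is logarithmic** (card
`trapped-set-observability-analyticity`, first lemma). For every `M > 0` and ball radius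
`ρ > 0` there are `δ > 0` and `C ≥ 0` such that for the Regge–Wheeler mode `(s, ℓ)`, `s ≤ 2`,
`s ≤ ℓ`, every global `C²` solution of finite non-zero energy which keeps all but a fraction `δ`
of its energy inside the FIXED tortoise ball `{|x − xc| ≤ ρ}` at time `+T` AND at time `−T`
(`exteriorEnergy … ρ (ψ(±T + ·)) 0` is the energy outside that ball at time `±T`) has
`T ≤ C (1 + log (ℓ + 1))`.  Semiclassics: the only phase-space point whose orbit stays in the
ball both ways is the hyperbolic top of the barrier (the photon orbit, Lyapunov rate
`ν = 1/(3√3 M)` uniformly in `ℓ`); a state concentrated there at both `∓T` must be squeezed below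
the uncertainty scale `ℓ^{-1/2} e^{−νT}` in the stable AND unstable directions, so
`T ≲ (2ν)⁻¹ log ℓ`; sub/super-barrier energy leaves the single-humped ball in time `O(ρ)` and
returns only through polynomially small tails. -/
def TwoSidedTrappingTime : Prop :=
  ∀ (M : ℝ), 0 < M → ∀ ρ : ℝ, 0 < ρ → ∃ δ C : ℝ, 0 < δ ∧ 0 ≤ C ∧
  ∀ (r : ℝ → ℝ) (xc : ℝ), IsTortoiseRadius M r xc →
  ∀ (s ℓ : ℕ), s ≤ 2 → s ≤ ℓ → ∀ ψ : ℝ → ℝ → ℝ, IsRWSolution M s ℓ r ψ →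
  totalEnergy (linePotential M s ℓ r) ψ 0 ≠ ⊤ → totalEnergy (linePotential M s ℓ r) ψ 0 ≠ 0 →
  ∀ T : ℝ, 0 ≤ T →
  exteriorEnergy (linePotential M s ℓ r) xc ρ (fun t x ↦ ψ (T + t) x) 0 ≤
      ENNReal.ofReal δ * totalEnergy (linePotential M s ℓ r) ψ T →
  exteriorEnergy (linePotential M s ℓ r) xc ρ (fun t x ↦ ψ (-T + t) x) 0 ≤
      ENNReal.ofReal δ * totalEnergy (linePotential M s ℓ r) ψ (-T) →
  T ≤ C * (1 + Real.log ((ℓ : ℝ) + 1))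

/-- Sanity: the dichotomy is pure topology — here is the one-line case split it rests on, for a
set already known to be preconnected. [folklore] -/
theorem subset_or_disjoint_of_isPreconnected {H : Type} [TopologicalSpace H]
    {Ω S K U : Set H} (hΩ : IsPreconnected Ω) (hK : IsClosed K) (hU : IsOpen U)
    (hUK : U ∩ S = K) (hΩS : Ω ⊆ S) : Ω ⊆ K ∨ Disjoint Ω K := by
  classical
  by_cases h : (Ω ∩ K).Nonempty
  · left
    -- Ω ⊆ U ∪ Kᶜ with both open; Ω meets U (through K ⊆ U); preconnected ⇒ cannot meet both sides
    have hKU : K ⊆ U := fun y hy ↦ (hUK.symm ▸ hy : y ∈ U ∩ S).1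
    have hcover : Ω ⊆ U ∪ Kᶜ := fun y _ ↦ by
      by_cases hy : y ∈ K
      · exact Or.inl (hKU hy)
      · exact Or.inr hy
    have hmeetU : (Ω ∩ U).Nonempty := by
      obtain ⟨y, hyΩ, hyK⟩ := h
      exact ⟨y, hyΩ, hKU hyK⟩
    intro y hyΩ
    by_contra hyK
    have hmeetC : (Ω ∩ Kᶜ).Nonempty := ⟨y, hyΩ, hyK⟩
    obtain ⟨z, hzΩ, hzU, hzC⟩ := hΩ U Kᶜ hU hK.isOpen_compl hcover hmeetU hmeetC
    exact hzC (hUK ▸ ⟨hzU, hΩS hzΩ⟩ : z ∈ K)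
  · right
    exact Set.disjoint_iff_inter_eq_empty.mpr (Set.not_nonempty_iff_eq_empty.mp h)

end Summit.FinalStateConjecture.FinalStateConjecture.Cruxes.ChannelsResolveTameDevelopmentsR

end
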